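import Summits.BirchSwinnertonDyer.BirchSwinnertonDyer.Theorems.QuadraticBranchSignedControlPlusEtaNonsurjConjADoorUpper
import Summits.BirchSwinnertonDyer.BirchSwinnertonDyer.Theorems.QuadraticBranchSignedControlPlusEtaNonsurjPrimeLFunctionRecordsA
import Summits.BirchSwinnertonDyer.BirchSwinnertonDyer.Theorems.QuadraticBranchSignedControlPlusEtaNonsurjPrimeLFunctionRecordsB
import Summits.BirchSwinnertonDyer.BirchSwinnertonDyer.Theorems.QuadraticBranchSignedControlPlusEtaNonsurjFineRoadRecordsC
import Summits.BirchSwinnertonDyer.BirchSwinnertonDyer.Theorems.QuadraticBranchSignedControlPlusEtaNonsurjFineRoadRecordsD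
import Summits.BirchSwinnertonDyer.BirchSwinnertonDyer.Theorems.QuadraticBranchSignedControlPlusEtaNonsurjFineRoadRecordsE
import Summits.BirchSwinnertonDyer.BirchSwinnertonDyer.Theorems.SignedLowerHalvesSprungLowerDivisibilityAtThreeControlAtT
import HarnessLib

/-!
# Route `QuadraticBranchSignedControl` (rung K8, cell `bsd-potss`), residual crux `PlusEtaMainConjectureNonsurj`
# (stmt-BirchSwinnertonDyer-19606): PRIME-`L` RECORDS THROUGH DOOR L6, part A — (C1⁺_η) at `p = 5` on NON-CM rank-one in-table rows with
# `λ⁺ = 1` from ONE class number `5 ∤ h(ℚ(P))` each: NO anchor, NO congruence, NO Hatley–Lei composite, NO Corpuz–Lei binder, NO `hS28`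
# (seat `bsd-potss-k8eta-c2` g20; census kit j323394, GRH)

WHAT. k8eta-c2 g4/g5's prime-`L` records (`EtaPrimeRoadRecords.etaMC_r1_<label>_<anchor>_5`) and g6/g8's fine-road / transfer records settled the
non-CM rank-`1` rows of crux 19606 below `5·10⁵` with `λ(L_5⁺(V,η,X)) = 1` through a CM unit ANCHOR congruent mod `5` (Kraus–Oesterlé certificate)
plus the Hatley–Lei `μ`-transfer (named composite wi-78102) or the Corpuz–Lei binder (preprint), and `hS28`. Door L6 (p690512) + the fine road
(p691623, `EtaConjADoor.quadraticBranchPlusEtaMainConjectureAt_of_not_dvd_classNumber_of_span_eq_span_X`) give the SAME conclusion from the ROW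
ALONE: named facts `h22 h41 h6273` (Kobayashi 2003) + `hGZK` (`Sel_{5^∞}(W/ℚ)` infinite from `r_an(W) = 1`); displayed per row: `r_an(W) = 1`
(Cremona), the tower clause, the shape `(L_5⁺(V,η,X)) = (X)` (PARI `λ⁺ = 1, μ⁺ = 0`, g3 table) and ONE class number `5 ∤ h(ℚ(P))`, `P ∈ W[5] ∖ 0`,
`[ℚ(P):ℚ] = 24` (this seat's census j323394, `bnfinit` under GRH). Part A: §1 the row-generic form `etaMC_r1_of_classNumber`; §2 the rows 26100h1, 78300bd1, 104400dc1, 159300h1, 243900o1, 243900p1 (h(ℚ(P)) = 1, 3, 2, 3, 1, 1). Part B: the seven rows of conductors 341775, 417600, 458100.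

HONEST FRAMING (cell `bsd-potss`; FULL-BSD rank ≤ 1 programme, HUMAN RULING D-0036/D-0074): per-row RECORDS, CONDITIONAL on the displayed named
facts and per-row inputs; the class numbers are GRH numerics (evidence, not facts); no stub of 19606 is proved by name; the crux stays OPEN;
nothing is booked; `BSD(W,5)` is claimed for no pair. `--supports stmt-BirchSwinnertonDyer-19606`.

References: [Kobayashi2003] §4 (p. 8), Thm. 4.1, Thm. 2.2, Thm. 7.3 i); [CoatesSujatha2005] §3 (A); [GrossZagier1986] Thm. (7.3); [Kolyvagin1990] Thm. A;
[Cremona1997] Table 1 (labels as listed).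
-/

set_option autoImplicit false
-- sibling precedent (`KatoDescentPotSupersingularAssembly.lean`): the directory name repeats the summit name
set_option linter.dupNamespace false
noncomputable section

open scoped Classical

open CongruenceSubgroup NumberField Field WeierstrassCurve
open Literature.NumberTheory.EllipticCurves Literature.NumberTheory.EllipticCurves.ModularForms
  Literature.NumberTheory.EllipticCurves.Rank1Residual Literature.NumberTheory.GaloisRepresentations
  Literature.NumberTheory.EllipticCurves.GreenbergVatsal2000 ZpExtension
open Summit.BirchSwinnertonDyer.Rank1Residual.Additive
open Summit.BirchSwinnertonDyer.BirchSwinnertonDyer.Theorems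

namespace Summit.BirchSwinnertonDyer.BirchSwinnertonDyer.Theorems.EtaConjADoorRecords

/-! ## §1 Row-generic form -/

/-- **(C1⁺_η) on a prime-`L` rank-one row from ONE class number** (row-generic record shape): `W/ℚ` elliptic with `r_an(W) = 1`, `p ≥ 5`,
`V` a globally minimal model of `W^{(p*)}` good at `p` with `a_p(V) = 0` and `p`-adic tower not onto, `(L_p⁺(V,η,X)) = (X)` for every
period-normalised choice, and some `P ∈ W[p] ∖ 0` with `p ∤ h(ℚ(P))` ⟹ `QuadraticBranchPlusEtaMainConjectureAt V p`. Named facts `h22 h41 h6273`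
and `hGZK` (`r_an = 1 ⟹ Sel_{p^∞}(W/ℚ)` infinite: tree `ChromaticCommonZerosControlAtT.not_finite_selmerGroupPInfty_of_analyticRank_eq_one`).
CONDITIONAL; nothing booked. [cite: Kobayashi2003, §4 Even main conjecture and Thm. 4.1 (p. 8), Thm. 7.3 i) (p. 13)]
[cite: CoatesSujatha2005, §3 statement (A)] [cite: GrossZagier1986, Thm. (7.3)] [cite: Kolyvagin1990, Thm. A] -/
theorem etaMC_r1_of_classNumber
    (h22 : Kobayashi2003.thm22_etaSignedSelmerDual_finite_torsion)
    (h41 : Kobayashi2003.thm41_plusEtaCharIdeal_dvd)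
    (h6273 : Kobayashi2003.thm62_63_73_etaColemanPoitouTate)
    (hGZK : rank_eq_analyticRank_of_analyticRank_le_one)
    (p : ℕ) [Fact p.Prime] [NeZero p] (hp5 : 5 ≤ p)
    (W : WeierstrassCurve ℚ) [W.IsElliptic] (hr : W.analyticRank = 1)
    (V : WeierstrassCurve ℚ) [V.IsElliptic] [V.IsGloballyMinimal] (C : VariableChange ℚ)
    (hC : C • W.quadraticTwist ((-1) ^ (p / 2) * p) = V)
    (hgood : V.HasGoodReductionAtPrime p) (hap : V.frobeniusTrace p = 0)
    (hns : ¬ ∀ m : ℕ, V.HasSurjectiveModNGaloisRep (p ^ m : ℕ))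
    (hX : ∀ {N : ℕ} [NeZero N] {f : CuspForm (Gamma0 N) 2}, IsNewformOf V f →
      ∀ (ϖ : ℚ), (if Even (p / 2) then (ϖ : ℝ) * V.realPeriodRat = plusPeriod f
          else (ϖ : ℝ) * V.imaginaryPeriodRat = minusPeriod f) →
      ∀ (Lη : IwasawaAlgebra p), IsQuadraticBranchPlusLFunction f p ϖ Lη →
        Ideal.span {Lη} = Ideal.span {(PowerSeries.X : IwasawaAlgebra p)})
    (hP : haveI : NumberField (W.divisionField p) := NumberField.mk
      ∃ P : geomTorsion W (p : ℤ), P ≠ 0 ∧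
        ¬ p ∣ NumberField.classNumber (IntermediateField.fixedField
          ((MulAction.stabilizer (absoluteGaloisGroup ℚ) P).map (absRestrictNormalHom (W.divisionField p))))) :
    QuadraticBranchPlusEtaMainConjectureAt V p :=
  EtaConjADoor.quadraticBranchPlusEtaMainConjectureAt_of_not_dvd_classNumber_of_span_eq_span_X V W C p h22 h41 h6273 hp5 hC
    hgood hap hns (ChromaticCommonZerosControlAtT.not_finite_selmerGroupPInfty_of_analyticRank_eq_one hGZK W p hr) hX hP

/-! ## §2 Rows (part A) -/

/-- **(C1⁺_η) at `p = 5` for every good `a_5 = 0` model `V` of the `5`-twist of `26100h1`** (`W = [0,0,0,-8625,644625]`, non-CM, `N = 26100`, Cremona `r_an = 1`,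
`Tam = 60`; PARI plus-`η` `(λ, μ) = (1, 0)`; census j323394: `h(ℚ(P)) = 1`) from the ROW ALONE — named facts `h22 h41 h6273 hGZK`; displayed
`r_an(W) = 1`, the tower clause, `(L_5⁺(V,η,X)) = (X)`, the class number. Instance of `etaMC_r1_of_classNumber`; `Δ(W) ≠ 0` reused
(`EtaPrimeRoadRecords.isElliptic_26100h1`). CONDITIONAL; nothing booked. [cite: Kobayashi2003, §4 (p. 8)] [cite: Cremona1997, Table 1 (label 26100h1)] -/
theorem etaMC_r1_26100h1_5_of_classNumber
    (h22 : Kobayashi2003.thm22_etaSignedSelmerDual_finite_torsion)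
    (h41 : Kobayashi2003.thm41_plusEtaCharIdeal_dvd)
    (h6273 : Kobayashi2003.thm62_63_73_etaColemanPoitouTate)
    (hGZK : rank_eq_analyticRank_of_analyticRank_le_one) [Fact (5 : ℕ).Prime]
    (W : WeierstrassCurve ℚ) (hW : W = (⟨0, 0, 0, (-8625), 644625⟩ : WeierstrassCurve ℚ)) (hr : W.analyticRank = 1)
    (V : WeierstrassCurve ℚ) [V.IsElliptic] [V.IsGloballyMinimal] (C : VariableChange ℚ)
    (hC : C • W.quadraticTwist 5 = V)
    (hgood : V.HasGoodReductionAtPrime 5) (hap : V.frobeniusTrace 5 = 0)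
    (hns : ¬ ∀ m : ℕ, V.HasSurjectiveModNGaloisRep (5 ^ m : ℕ))
    (hX : ∀ {N : ℕ} [NeZero N] {f : CuspForm (Gamma0 N) 2}, IsNewformOf V f →
      ∀ (ϖ : ℚ), (if Even (5 / 2) then (ϖ : ℝ) * V.realPeriodRat = plusPeriod f
          else (ϖ : ℝ) * V.imaginaryPeriodRat = minusPeriod f) →
      ∀ (Lη : IwasawaAlgebra 5), IsQuadraticBranchPlusLFunction f 5 ϖ Lη →
        Ideal.span {Lη} = Ideal.span {(PowerSeries.X : IwasawaAlgebra 5)})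
    (hP : haveI : W.IsElliptic := hW ▸ EtaPrimeRoadRecords.isElliptic_26100h1
      haveI : NeZero (5 : ℕ) := ⟨by norm_num⟩
      haveI : NumberField (W.divisionField 5) := NumberField.mk
      ∃ P : geomTorsion W ((5 : ℕ) : ℤ), P ≠ 0 ∧
        ¬ 5 ∣ NumberField.classNumber (IntermediateField.fixedField
          ((MulAction.stabilizer (absoluteGaloisGroup ℚ) P).map
            (absRestrictNormalHom (W.divisionField 5))))) :
    QuadraticBranchPlusEtaMainConjectureAt V 5 := by
  subst hW
  haveI : (⟨0, 0, 0, (-8625), 644625⟩ : WeierstrassCurve ℚ).IsElliptic := EtaPrimeRoadRecords.isElliptic_26100h1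
  haveI : NeZero (5 : ℕ) := ⟨by norm_num⟩
  exact etaMC_r1_of_classNumber h22 h41 h6273 hGZK 5 (le_refl 5) _ hr V C
    (by rw [show ((-1 : ℚ) ^ ((5 : ℕ) / 2) * ((5 : ℕ) : ℚ)) = 5 by norm_num]; exact hC) hgood hap hns hX hP

/-- **(C1⁺_η) at `p = 5` for every good `a_5 = 0` model `V` of the `5`-twist of `78300bd1`** (`W = [0,0,0,-78375,-5017250]`, non-CM, `N = 78300`, Cremona `r_an = 1`,
`Tam = 6`; PARI plus-`η` `(λ, μ) = (1, 0)`; census j323394: `h(ℚ(P)) = 3`) from the ROW ALONE — named facts `h22 h41 h6273 hGZK`; displayed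
`r_an(W) = 1`, the tower clause, `(L_5⁺(V,η,X)) = (X)`, the class number. Instance of `etaMC_r1_of_classNumber`; `Δ(W) ≠ 0` reused
(`EtaFineRoadRecords.isElliptic_78300bd1`). CONDITIONAL; nothing booked. [cite: Kobayashi2003, §4 (p. 8)] [cite: Cremona1997, Table 1 (label 78300bd1)] -/
theorem etaMC_r1_78300bd1_5_of_classNumber
    (h22 : Kobayashi2003.thm22_etaSignedSelmerDual_finite_torsion)
    (h41 : Kobayashi2003.thm41_plusEtaCharIdeal_dvd)
    (h6273 : Kobayashi2003.thm62_63_73_etaColemanPoitouTate)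
    (hGZK : rank_eq_analyticRank_of_analyticRank_le_one) [Fact (5 : ℕ).Prime]
    (W : WeierstrassCurve ℚ) (hW : W = (⟨0, 0, 0, (-78375), (-5017250)⟩ : WeierstrassCurve ℚ)) (hr : W.analyticRank = 1)
    (V : WeierstrassCurve ℚ) [V.IsElliptic] [V.IsGloballyMinimal] (C : VariableChange ℚ)
    (hC : C • W.quadraticTwist 5 = V)
    (hgood : V.HasGoodReductionAtPrime 5) (hap : V.frobeniusTrace 5 = 0)
    (hns : ¬ ∀ m : ℕ, V.HasSurjectiveModNGaloisRep (5 ^ m : ℕ))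
    (hX : ∀ {N : ℕ} [NeZero N] {f : CuspForm (Gamma0 N) 2}, IsNewformOf V f →
      ∀ (ϖ : ℚ), (if Even (5 / 2) then (ϖ : ℝ) * V.realPeriodRat = plusPeriod f
          else (ϖ : ℝ) * V.imaginaryPeriodRat = minusPeriod f) →
      ∀ (Lη : IwasawaAlgebra 5), IsQuadraticBranchPlusLFunction f 5 ϖ Lη →
        Ideal.span {Lη} = Ideal.span {(PowerSeries.X : IwasawaAlgebra 5)})
    (hP : haveI : W.IsElliptic := hW ▸ EtaFineRoadRecords.isElliptic_78300bd1
      haveI : NeZero (5 : ℕ) := ⟨by norm_num⟩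
      haveI : NumberField (W.divisionField 5) := NumberField.mk
      ∃ P : geomTorsion W ((5 : ℕ) : ℤ), P ≠ 0 ∧
        ¬ 5 ∣ NumberField.classNumber (IntermediateField.fixedField
          ((MulAction.stabilizer (absoluteGaloisGroup ℚ) P).map
            (absRestrictNormalHom (W.divisionField 5))))) :
    QuadraticBranchPlusEtaMainConjectureAt V 5 := by
  subst hW
  haveI : (⟨0, 0, 0, (-78375), (-5017250)⟩ : WeierstrassCurve ℚ).IsElliptic := EtaFineRoadRecords.isElliptic_78300bd1
  haveI : NeZero (5 : ℕ) := ⟨by norm_num⟩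
  exact etaMC_r1_of_classNumber h22 h41 h6273 hGZK 5 (le_refl 5) _ hr V C
    (by rw [show ((-1 : ℚ) ^ ((5 : ℕ) / 2) * ((5 : ℕ) : ℚ)) = 5 by norm_num]; exact hC) hgood hap hns hX hP

/-- **(C1⁺_η) at `p = 5` for every good `a_5 = 0` model `V` of the `5`-twist of `104400dc1`** (`W = [0,0,0,-8625,-644625]`, non-CM, `N = 104400`, Cremona `r_an = 1`,
`Tam = 20`; PARI plus-`η` `(λ, μ) = (1, 0)`; census j323394: `h(ℚ(P)) = 2`) from the ROW ALONE — named facts `h22 h41 h6273 hGZK`; displayed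
`r_an(W) = 1`, the tower clause, `(L_5⁺(V,η,X)) = (X)`, the class number. Instance of `etaMC_r1_of_classNumber`; `Δ(W) ≠ 0` reused
(`EtaPrimeRoadRecords.isElliptic_104400dc1`). CONDITIONAL; nothing booked. [cite: Kobayashi2003, §4 (p. 8)] [cite: Cremona1997, Table 1 (label 104400dc1)] -/
theorem etaMC_r1_104400dc1_5_of_classNumber
    (h22 : Kobayashi2003.thm22_etaSignedSelmerDual_finite_torsion)
    (h41 : Kobayashi2003.thm41_plusEtaCharIdeal_dvd)
    (h6273 : Kobayashi2003.thm62_63_73_etaColemanPoitouTate)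
    (hGZK : rank_eq_analyticRank_of_analyticRank_le_one) [Fact (5 : ℕ).Prime]
    (W : WeierstrassCurve ℚ) (hW : W = (⟨0, 0, 0, (-8625), (-644625)⟩ : WeierstrassCurve ℚ)) (hr : W.analyticRank = 1)
    (V : WeierstrassCurve ℚ) [V.IsElliptic] [V.IsGloballyMinimal] (C : VariableChange ℚ)
    (hC : C • W.quadraticTwist 5 = V)
    (hgood : V.HasGoodReductionAtPrime 5) (hap : V.frobeniusTrace 5 = 0)
    (hns : ¬ ∀ m : ℕ, V.HasSurjectiveModNGaloisRep (5 ^ m : ℕ))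
    (hX : ∀ {N : ℕ} [NeZero N] {f : CuspForm (Gamma0 N) 2}, IsNewformOf V f →
      ∀ (ϖ : ℚ), (if Even (5 / 2) then (ϖ : ℝ) * V.realPeriodRat = plusPeriod f
          else (ϖ : ℝ) * V.imaginaryPeriodRat = minusPeriod f) →
      ∀ (Lη : IwasawaAlgebra 5), IsQuadraticBranchPlusLFunction f 5 ϖ Lη →
        Ideal.span {Lη} = Ideal.span {(PowerSeries.X : IwasawaAlgebra 5)})
    (hP : haveI : W.IsElliptic := hW ▸ EtaPrimeRoadRecords.isElliptic_104400dc1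
      haveI : NeZero (5 : ℕ) := ⟨by norm_num⟩
      haveI : NumberField (W.divisionField 5) := NumberField.mk
      ∃ P : geomTorsion W ((5 : ℕ) : ℤ), P ≠ 0 ∧
        ¬ 5 ∣ NumberField.classNumber (IntermediateField.fixedField
          ((MulAction.stabilizer (absoluteGaloisGroup ℚ) P).map
            (absRestrictNormalHom (W.divisionField 5))))) :
    QuadraticBranchPlusEtaMainConjectureAt V 5 := by
  subst hW
  haveI : (⟨0, 0, 0, (-8625), (-644625)⟩ : WeierstrassCurve ℚ).IsElliptic := EtaPrimeRoadRecords.isElliptic_104400dc1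
  haveI : NeZero (5 : ℕ) := ⟨by norm_num⟩
  exact etaMC_r1_of_classNumber h22 h41 h6273 hGZK 5 (le_refl 5) _ hr V C
    (by rw [show ((-1 : ℚ) ^ ((5 : ℕ) / 2) * ((5 : ℕ) : ℚ)) = 5 by norm_num]; exact hC) hgood hap hns hX hP

/-- **(C1⁺_η) at `p = 5` for every good `a_5 = 0` model `V` of the `5`-twist of `159300h1`** (`W = [0,0,0,-1090125,-344428875]`, non-CM, `N = 159300`, Cremona `r_an = 1`,
`Tam = 6`; PARI plus-`η` `(λ, μ) = (1, 0)`; census j323394: `h(ℚ(P)) = 3`) from the ROW ALONE — named facts `h22 h41 h6273 hGZK`; displayed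
`r_an(W) = 1`, the tower clause, `(L_5⁺(V,η,X)) = (X)`, the class number. Instance of `etaMC_r1_of_classNumber`; `Δ(W) ≠ 0` reused
(`EtaFineRoadRecords.isElliptic_159300h1`). CONDITIONAL; nothing booked. [cite: Kobayashi2003, §4 (p. 8)] [cite: Cremona1997, Table 1 (label 159300h1)] -/
theorem etaMC_r1_159300h1_5_of_classNumber
    (h22 : Kobayashi2003.thm22_etaSignedSelmerDual_finite_torsion)
    (h41 : Kobayashi2003.thm41_plusEtaCharIdeal_dvd)
    (h6273 : Kobayashi2003.thm62_63_73_etaColemanPoitouTate)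
    (hGZK : rank_eq_analyticRank_of_analyticRank_le_one) [Fact (5 : ℕ).Prime]
    (W : WeierstrassCurve ℚ) (hW : W = (⟨0, 0, 0, (-1090125), (-344428875)⟩ : WeierstrassCurve ℚ)) (hr : W.analyticRank = 1)
    (V : WeierstrassCurve ℚ) [V.IsElliptic] [V.IsGloballyMinimal] (C : VariableChange ℚ)
    (hC : C • W.quadraticTwist 5 = V)
    (hgood : V.HasGoodReductionAtPrime 5) (hap : V.frobeniusTrace 5 = 0)
    (hns : ¬ ∀ m : ℕ, V.HasSurjectiveModNGaloisRep (5 ^ m : ℕ))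
    (hX : ∀ {N : ℕ} [NeZero N] {f : CuspForm (Gamma0 N) 2}, IsNewformOf V f →
      ∀ (ϖ : ℚ), (if Even (5 / 2) then (ϖ : ℝ) * V.realPeriodRat = plusPeriod f
          else (ϖ : ℝ) * V.imaginaryPeriodRat = minusPeriod f) →
      ∀ (Lη : IwasawaAlgebra 5), IsQuadraticBranchPlusLFunction f 5 ϖ Lη →
        Ideal.span {Lη} = Ideal.span {(PowerSeries.X : IwasawaAlgebra 5)})
    (hP : haveI : W.IsElliptic := hW ▸ EtaFineRoadRecords.isElliptic_159300h1
      haveI : NeZero (5 : ℕ) := ⟨by norm_num⟩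
      haveI : NumberField (W.divisionField 5) := NumberField.mk
      ∃ P : geomTorsion W ((5 : ℕ) : ℤ), P ≠ 0 ∧
        ¬ 5 ∣ NumberField.classNumber (IntermediateField.fixedField
          ((MulAction.stabilizer (absoluteGaloisGroup ℚ) P).map
            (absRestrictNormalHom (W.divisionField 5))))) :
    QuadraticBranchPlusEtaMainConjectureAt V 5 := by
  subst hW
  haveI : (⟨0, 0, 0, (-1090125), (-344428875)⟩ : WeierstrassCurve ℚ).IsElliptic := EtaFineRoadRecords.isElliptic_159300h1
  haveI : NeZero (5 : ℕ) := ⟨by norm_num⟩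
  exact etaMC_r1_of_classNumber h22 h41 h6273 hGZK 5 (le_refl 5) _ hr V C
    (by rw [show ((-1 : ℚ) ^ ((5 : ℕ) / 2) * ((5 : ℕ) : ℚ)) = 5 by norm_num]; exact hC) hgood hap hns hX hP

/-- **(C1⁺_η) at `p = 5` for every good `a_5 = 0` model `V` of the `5`-twist of `243900o1`** (`W = [0,0,0,-2607000,-1503171500]`, non-CM, `N = 243900`, Cremona `r_an = 1`,
`Tam = 20`; PARI plus-`η` `(λ, μ) = (1, 0)`; census j323394: `h(ℚ(P)) = 1`) from the ROW ALONE — named facts `h22 h41 h6273 hGZK`; displayed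
`r_an(W) = 1`, the tower clause, `(L_5⁺(V,η,X)) = (X)`, the class number. Instance of `etaMC_r1_of_classNumber`; `Δ(W) ≠ 0` reused
(`EtaPrimeRoadRecords.isElliptic_243900o1`). CONDITIONAL; nothing booked. [cite: Kobayashi2003, §4 (p. 8)] [cite: Cremona1997, Table 1 (label 243900o1)] -/
theorem etaMC_r1_243900o1_5_of_classNumber
    (h22 : Kobayashi2003.thm22_etaSignedSelmerDual_finite_torsion)
    (h41 : Kobayashi2003.thm41_plusEtaCharIdeal_dvd)
    (h6273 : Kobayashi2003.thm62_63_73_etaColemanPoitouTate)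
    (hGZK : rank_eq_analyticRank_of_analyticRank_le_one) [Fact (5 : ℕ).Prime]
    (W : WeierstrassCurve ℚ) (hW : W = (⟨0, 0, 0, (-2607000), (-1503171500)⟩ : WeierstrassCurve ℚ)) (hr : W.analyticRank = 1)
    (V : WeierstrassCurve ℚ) [V.IsElliptic] [V.IsGloballyMinimal] (C : VariableChange ℚ)
    (hC : C • W.quadraticTwist 5 = V)
    (hgood : V.HasGoodReductionAtPrime 5) (hap : V.frobeniusTrace 5 = 0)
    (hns : ¬ ∀ m : ℕ, V.HasSurjectiveModNGaloisRep (5 ^ m : ℕ))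
    (hX : ∀ {N : ℕ} [NeZero N] {f : CuspForm (Gamma0 N) 2}, IsNewformOf V f →
      ∀ (ϖ : ℚ), (if Even (5 / 2) then (ϖ : ℝ) * V.realPeriodRat = plusPeriod f
          else (ϖ : ℝ) * V.imaginaryPeriodRat = minusPeriod f) →
      ∀ (Lη : IwasawaAlgebra 5), IsQuadraticBranchPlusLFunction f 5 ϖ Lη →
        Ideal.span {Lη} = Ideal.span {(PowerSeries.X : IwasawaAlgebra 5)})
    (hP : haveI : W.IsElliptic := hW ▸ EtaPrimeRoadRecords.isElliptic_243900o1
      haveI : NeZero (5 : ℕ) := ⟨by norm_num⟩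
      haveI : NumberField (W.divisionField 5) := NumberField.mk
      ∃ P : geomTorsion W ((5 : ℕ) : ℤ), P ≠ 0 ∧
        ¬ 5 ∣ NumberField.classNumber (IntermediateField.fixedField
          ((MulAction.stabilizer (absoluteGaloisGroup ℚ) P).map
            (absRestrictNormalHom (W.divisionField 5))))) :
    QuadraticBranchPlusEtaMainConjectureAt V 5 := by
  subst hW
  haveI : (⟨0, 0, 0, (-2607000), (-1503171500)⟩ : WeierstrassCurve ℚ).IsElliptic := EtaPrimeRoadRecords.isElliptic_243900o1
  haveI : NeZero (5 : ℕ) := ⟨by norm_num⟩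
  exact etaMC_r1_of_classNumber h22 h41 h6273 hGZK 5 (le_refl 5) _ hr V C
    (by rw [show ((-1 : ℚ) ^ ((5 : ℕ) / 2) * ((5 : ℕ) : ℚ)) = 5 by norm_num]; exact hC) hgood hap hns hX hP

/-- **(C1⁺_η) at `p = 5` for every good `a_5 = 0` model `V` of the `5`-twist of `243900p1`** (`W = [0,0,0,-23463000,40585630500]`, non-CM, `N = 243900`, Cremona `r_an = 1`,
`Tam = 60`; PARI plus-`η` `(λ, μ) = (1, 0)`; census j323394: `h(ℚ(P)) = 1`) from the ROW ALONE — named facts `h22 h41 h6273 hGZK`; displayed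
`r_an(W) = 1`, the tower clause, `(L_5⁺(V,η,X)) = (X)`, the class number. Instance of `etaMC_r1_of_classNumber`; `Δ(W) ≠ 0` reused
(`EtaPrimeRoadRecords.isElliptic_243900p1`). CONDITIONAL; nothing booked. [cite: Kobayashi2003, §4 (p. 8)] [cite: Cremona1997, Table 1 (label 243900p1)] -/
theorem etaMC_r1_243900p1_5_of_classNumber
    (h22 : Kobayashi2003.thm22_etaSignedSelmerDual_finite_torsion)
    (h41 : Kobayashi2003.thm41_plusEtaCharIdeal_dvd)
    (h6273 : Kobayashi2003.thm62_63_73_etaColemanPoitouTate)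
    (hGZK : rank_eq_analyticRank_of_analyticRank_le_one) [Fact (5 : ℕ).Prime]
    (W : WeierstrassCurve ℚ) (hW : W = (⟨0, 0, 0, (-23463000), 40585630500⟩ : WeierstrassCurve ℚ)) (hr : W.analyticRank = 1)
    (V : WeierstrassCurve ℚ) [V.IsElliptic] [V.IsGloballyMinimal] (C : VariableChange ℚ)
    (hC : C • W.quadraticTwist 5 = V)
    (hgood : V.HasGoodReductionAtPrime 5) (hap : V.frobeniusTrace 5 = 0)
    (hns : ¬ ∀ m : ℕ, V.HasSurjectiveModNGaloisRep (5 ^ m : ℕ))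
    (hX : ∀ {N : ℕ} [NeZero N] {f : CuspForm (Gamma0 N) 2}, IsNewformOf V f →
      ∀ (ϖ : ℚ), (if Even (5 / 2) then (ϖ : ℝ) * V.realPeriodRat = plusPeriod f
          else (ϖ : ℝ) * V.imaginaryPeriodRat = minusPeriod f) →
      ∀ (Lη : IwasawaAlgebra 5), IsQuadraticBranchPlusLFunction f 5 ϖ Lη →
        Ideal.span {Lη} = Ideal.span {(PowerSeries.X : IwasawaAlgebra 5)})
    (hP : haveI : W.IsElliptic := hW ▸ EtaPrimeRoadRecords.isElliptic_243900p1
      haveI : NeZero (5 : ℕ) := ⟨by norm_num⟩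
      haveI : NumberField (W.divisionField 5) := NumberField.mk
      ∃ P : geomTorsion W ((5 : ℕ) : ℤ), P ≠ 0 ∧
        ¬ 5 ∣ NumberField.classNumber (IntermediateField.fixedField
          ((MulAction.stabilizer (absoluteGaloisGroup ℚ) P).map
            (absRestrictNormalHom (W.divisionField 5))))) :
    QuadraticBranchPlusEtaMainConjectureAt V 5 := by
  subst hW
  haveI : (⟨0, 0, 0, (-23463000), 40585630500⟩ : WeierstrassCurve ℚ).IsElliptic := EtaPrimeRoadRecords.isElliptic_243900p1
  haveI : NeZero (5 : ℕ) := ⟨by norm_num⟩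
  exact etaMC_r1_of_classNumber h22 h41 h6273 hGZK 5 (le_refl 5) _ hr V C
    (by rw [show ((-1 : ℚ) ^ ((5 : ℕ) / 2) * ((5 : ℕ) : ℚ)) = 5 by norm_num]; exact hC) hgood hap hns hX hP

end Summit.BirchSwinnertonDyer.BirchSwinnertonDyer.Theorems.EtaConjADoorRecords

end
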